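import Summits.QuantumFields.YangMills.Theorems.BalabanUVNodesN22W1StripTermIndexed
import Summits.QuantumFields.YangMills.Theorems.BalabanUVNodesRateReadingOfRecord13

/-!
# BalabanUVNodes ∕ node N22 = NE9 — THE STRIP INDUCTION AT THE W1 OBJECT, MODULE 24′: THE TERM-INDEXED LEAF IN THE K3‴ SKELETON's OWN CURRENCY — N22's conjunct of
# `KeyedRates rr` at the LEVEL-SELECTED tuple reading of record on the generated run towers, from node N18 below the selected run length + the three PER-TERM schemas of
# a term functional identified with the generator at the selected run length

Cell `pub-ymgap`, HUMAN RULING D-0062 (Track A), R134 ACCELERATION re-seat `pub-ymgap-dag-n22-c` (strategy s1), generation 5, module 24′.  THEOREMS ONLY; imports module 22′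
`…N22W1StripTermIndexed` (§1 `stepSchemaLoc∕226∕Last_ofTerms_of_termwise`; transitively 19′ §3 `n22At_u3OfRecord₁₂_ofRecordAdm_runTowers_toClusterTower_of_n18Below_threeSchemas`,
node00-def-W1 g6's `GenTower.ofTerms`) and dag-n22-e g5's module 6″ `…RateReadingOfRecord13` (p495075: `readingOfRecord₁₃`, `readingOfRecord₁₃_bundle_u3`; transitively layer B
₁₃ `rateCarriersOfRecord₁₃`, `u3OfRecord₁₃_eq_u3OfRecord₁₂`) BY NAME.  `--supports` K3‴ `SpineGivenEndpointR13` (stmt-QuantumFields-19912) as a helper.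

WHY.  plan g66's `K3Skeleton13.lean` registers `stub_rates13 : ∃ rr : RateReading 2, KeyedRates rr ∧ KeyedWindow rr` with `KeyedRates rr := ∀ F θ hP, θ.Admissible F N → ∀ g₀ os,
RatesAt (datumOfRecord₁₃ F N θ hP) (rr F θ hP g₀ os)`; N22's conjunct there is `N22At (rr F θ hP g₀ os).u3`, and the home's witness (n22-e 5″ §5, 8c″ §4) is the
LEVEL-SELECTED tuple reading of record `rr F θ hP g₀ os := rateCarriersOfRecord₁₃ (readingOfRecord₁₃ w1 ℓ₃ ne2 ne1) F θ hP g₀ os (ksel F θ g₀ os)`.  dag-n22-e's 8c″ §4 supplies that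
conjunct from the s2 («analytic currency») package; THIS FILE supplies it from the s1 line's TERM-LEVEL package of module 22′ — so both N22 lines meet the skeleton at the same
binder, and the s1 inputs at that binder are: node N18 below the selected run length at the same reading, the `hspk` inclusion, numerals, and per `(F, θ, g₀, os)` a term
functional `TF` with `Gn F θ (ksel …) = GenTower.ofTerms L TF` and its three per-term properties (S-loc-T) ∕ (S-226-T) ∕ (S-last-T) below the selected run length.

WHAT.
* §1 `n22At_u3OfRecord₁₂_ofRecordAdm_runTowers_toClusterTower_of_n18Below_termFunEq` — the θ-free engine (Stage-12 tuple) for a generator-valued `Gn` over all run lengths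
  IDENTIFIED at the run length `k` with a term-indexed one (`Gn k = GenTower.ofTerms L TF`); 22′ §2 is its `rfl` instance.
* §2 `n22At_u3OfRecord₁₃_ofRecordAdm_runTowers_toClusterTower_of_n18Below_termFunEq` — the same at one Stage-13 tuple (`θ.toStage12Params`, n22-e's rfl bridge).
* §3 ★ `n22_tupleReadingOfRecord_termFun_of_n18Below_termSchemas` (the skeleton's unguarded binder) · `n22_tupleReadingOfRecordOn_termFun_of_n18Below_termSchemas` (guarded by any
  regime `Rg`, e.g. rev 16's `(θ.ZtUnity F N ∧ θ.SlotsNondegenerate₁₃ F N)`).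

HONEST FRAMING.  Count-neutral by-name knit; NOT a discharge of N22 and NOT a closer of `stub_rates13` (one conjunct of six, at a reading whose generator `Gn`, tables `sp`, gauges,
transport, letters and `ne2 ∕ ne1` are residual DATA; the term functional and its three per-term properties are DISPLAYED hypotheses — [II] (2.26) per term with complex
parameters, NOT PRINTED as such; `S_N18`-below is node N18's; no inhabitant of `IsDatumOfRecord₁₃C` ∕ no admissible tuple claimed (K0‴ OPEN); vacuous where `AdmBg … = ∅`,
21′ §4 names the inhabited case).  NE9 NOT IN PRINT for d = 4; one finite four-torus programme at fixed ε — NOT infinite volume, NOT OS on ℝ⁴, NOT a mass gap, NOT Clay.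
0 `sorry`, 0 `def`, standard axioms.

References (TYPES only): [I] = [Balaban1987RG1] (0.23)–(0.25) pp. 256–257, §1 p. 263, (2.12)–(2.13) p. 268; [II] = [Balaban1988RG2Cluster] (2.9)–(2.15) pp. 14–15, (2.26)
p. 17, Lemma 3 p. 20, (2.39)–(2.41) p. 21.
-/

noncomputable section

open scoped Matrix.Norms.L2Operator

namespace YMDAG.N22.W1

open Set Metric
open scoped BigOperators
open Literature.MathematicalPhysics.QuantumFieldTheory.Balaban1983to89
open Literature.MathematicalPhysics.QuantumFieldTheory.Balaban1983to89.T4Continuum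
open Literature.MathematicalPhysics.QuantumFieldTheory.Balaban1983to89.T4OutputRate
open Literature.MathematicalPhysics.QuantumFieldTheory.Balaban1983to89.TreeLengthTorus (TPt TDom tsys torusTreeLen torusTreeLen_nonneg)
open Literature.MathematicalPhysics.QuantumFieldTheory.Balaban1983to89.B12TreeDecay (K₀ K₀_pos)
open Literature.MathematicalPhysics.QuantumFieldTheory.Balaban1983to89.B13Lemma3TorusData (TBond)
open Literature.MathematicalPhysics.QuantumFieldTheory.Balaban1983to89.B13Lemma3TorusTerms (terms weight weight_nonneg)
open Literature.MathematicalPhysics.QuantumFieldTheory.Balaban1983to89.B13Lemma3TorusSocket (Lemma3Numerics)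
open Literature.MathematicalPhysics.QuantumFieldTheory.Balaban1983to89.Step (SFConsts)
open Literature.MathematicalPhysics.QuantumFieldTheory.Balaban1983to89.Node00
  (Stage12Params Stage13Params IsDatumOfRecord₁₂C IsDatumOfRecord₁₃C U3Objects₁₁ U3Letters₁₁ NE2Objects₁₁ NE3Letters₁₁ MatA ιSU prependCoupling)
open Literature.MathematicalPhysics.QuantumFieldTheory.Balaban1983to89.Node00.Sect2 (domSys domCount CPair ofBackgroundC spaceI domSites Setting Residual)
open Literature.MathematicalPhysics.QuantumFieldTheory.Balaban1983to89.Node00.W1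
open YMDAG.UVSplit

variable {N : ℕ} [NeZero N]

/-! ## §1 The θ-free engine for a generator identified at the run length with a term-indexed one -/

section TermFunEq

variable {F : T4Family} {M : ℕ} [NeZero M] {L : ℕ} [NeZero L] (Gn : (k₁ : ℕ) → GenTower (F.P k₁) (MatA N) M)
  (sp : (k j : ℕ) → (domSys (F.P k) M j).Dom → Set (CPair (F.P k) (MatA N)))
  (gauge : (k : ℕ) → GaugeField (F.P k) 0 (Node00.SU N) → GaugeField (F.P k) 0 (Node00.SU N) → ℝ) (hg : ∀ k U U', 0 ≤ gauge k U U')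
  (T₀ : (k : ℕ) → GaugeField (F.P (k + 1)) 0 (Node00.SU N) → GaugeField (F.P k) 0 (Node00.SU N))
  (hT₀ : ∀ (k : ℕ) (U : GaugeField (F.P (k + 1)) 0 (Node00.SU N)),
    (∀ (j : ℕ) (Y : (domSys (F.P (k + 1)) M j).Dom), ofBackgroundC (ιSU N) U ∈ sp (k + 1) j Y) →
    ∀ (j : ℕ) (Y : (domSys (F.P k) M j).Dom), ofBackgroundC (ιSU N) (T₀ k U) ∈ sp k j Y)
  (li : LetterInputs) (θ : Stage12Params F N) (k : ℕ) (TF : GenTermFun (F.P k) (MatA N) M L) {G : Type*} [GaugeGroup G]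
  (Sg : Setting (MatA N) G) (Rz : Residual (F.P k) (MatA N))

open Classical in
/-- **`N22At` AT THE ADMISSIBLE READING OF RECORD ON GENERATED RUN TOWERS WHOSE GENERATOR AT THE RUN LENGTH `k` IS TERM-INDEXED** (`Gn k = GenTower.ofTerms L TF`; the other
run lengths' generators free): node N18 below + `hspk` + numerals + signs + for `k′ < k` and `t ∈ terms L M Z` the three PER-TERM schemas of `TF k′ Z t` — (S-loc-T), (S-226-T)
([II] (2.26) per term, complex older terms; node N10), (S-last-T) ([II] (2.26) per term, complex last coupling; node N09) ⟹ `N22At (u3OfRecord₁₂ θ (Dr.u3Objects θ.γ) k)` (19′ §3 with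
22′ §1's schemas transported along the identification). [cite: Balaban1988RG2Cluster, (2.9)-(2.15) pp.14-15, (2.26) p.17, Lemma 3 p.20 and (2.39)-(2.41) p.21; Balaban1987RG1, §1 p.263 and (2.12)-(2.13) p.268] -/
theorem n22At_u3OfRecord₁₂_ofRecordAdm_runTowers_toClusterTower_of_n18Below_termFunEq {cs : SFConsts} (hGn : Gn k = GenTower.ofTerms L TF)
    (hspk : ∀ (j : ℕ) (Y : (domSys (F.P k) M j).Dom), sp k j Y ⊆ spaceI Sg Rz M j (domSites (F.P k) M j Y) cs.α₀ cs.α₁)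
    (c : B13.Consts) (hL : 8 ≤ c.L) (hLc : c.L = L) {a a₂ a₂' a₅ Aabs : ℝ}
    (hN : Lemma3Numerics c M ((c.L : ℝ) / 2) a a₂ a₂' a₅ Aabs) {r₁ : ℝ} (hA0 : 0 ≤ c.C3act * c.ε₁) (hr₁ : 0 ≤ r₁) (hκ : li.κ ≤ r₁)
    (hrate : r₁ + 2 * (64 * Real.log 162) + 2 ≤ (1 - 8 * c.δ) * ((c.L : ℝ) / 2) * c.κ)
    (hsmall : c.C3act * c.ε₁ * Real.exp (5 * r₁ + 1) * K₀ 64 8 * 9 * 64 ≤ 1)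
    (hrenew : Real.exp 1 * 9 * 64 * K₀ 64 8 ^ 2 * (c.C3act * c.ε₁) ≤ li.A)
    (hlocT : ∀ (k' : ℕ), k' < k → ∀ (t : ℂ) (old old' : OlderTerms (F.P k) (MatA N) M k') (φ : CPair (F.P k) (MatA N))
      (Z : (domSys (F.P k) M (k' + 1)).Dom),
      (∀ (j : Fin (k' + 1)) (Y : (domSys (F.P k) M j).Dom) (ψ : CPair (F.P k) (MatA N)), ψ ∈ spaceI Sg Rz M j (domSites (F.P k) M j Y) cs.α₀ cs.α₁ →
        old j Y ψ = old' j Y ψ) →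
      ∀ s ∈ terms L M Z, TF k' Z s t old φ = TF k' Z s t old' φ)
    (h226T : ∀ (k' : ℕ), k' < k → ∀ (D : Set ℂ), IsOpen D → (∀ t ∈ Ioc (0 : ℝ) θ.γ, closedBall (t : ℂ) li.r ⊆ D) → ∀ (s : ℝ), s ∈ Ioc (0 : ℝ) θ.γ →
      ∀ (cv : ℂ → OlderTerms (F.P k) (MatA N) M k'),
      (∀ (j : Fin (k' + 1)) (Y : (domSys (F.P k) M j).Dom) (ψ : CPair (F.P k) (MatA N)), ψ ∈ spaceI Sg Rz M j (domSites (F.P k) M j Y) cs.α₀ cs.α₁ →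
        DifferentiableOn ℂ (fun z => cv z j Y ψ) D ∧ ∀ z ∈ D, ‖cv z j Y ψ‖ ≤ li.A * Real.exp (-(li.κ * torusTreeLen Y.1))) →
      ∀ (X : (domSys (F.P k) M (k' + 1)).Dom) (φ : CPair (F.P k) (MatA N)), φ ∈ spaceI Sg Rz M (k' + 1) (domSites (F.P k) M (k' + 1) X) cs.α₀ cs.α₁ →
      ∀ (Z : (domSys (F.P k) M (k' + 1)).Dom), Z.1 ⊆ X.1 → ∀ t ∈ terms L M Z,
        DifferentiableOn ℂ (fun z => TF k' Z t (s : ℂ) (cv z) φ) D ∧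
        ∀ z ∈ D, ‖TF k' Z t (s : ℂ) (cv z) φ‖ ≤ weight L M c Z a t * Real.exp (a₅ * ((Z.1).card : ℝ)))
    (hlastT : ∀ (k' : ℕ), k' < k → ∀ (old : OlderTerms (F.P k) (MatA N) M k'), ∃ U : Set ℂ, IsOpen U ∧ (∀ t ∈ Ioc (0 : ℝ) θ.γ, closedBall (t : ℂ) li.r ⊆ U) ∧
      ((∀ (j : Fin (k' + 1)) (Y : (domSys (F.P k) M j).Dom) (ψ : CPair (F.P k) (MatA N)), ψ ∈ spaceI Sg Rz M j (domSites (F.P k) M j Y) cs.α₀ cs.α₁ →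
          ‖old j Y ψ‖ ≤ li.A * Real.exp (-(li.κ * torusTreeLen Y.1))) →
        ∀ (X : (domSys (F.P k) M (k' + 1)).Dom) (φ : CPair (F.P k) (MatA N)), φ ∈ spaceI Sg Rz M (k' + 1) (domSites (F.P k) M (k' + 1) X) cs.α₀ cs.α₁ →
          ∀ (Z : (domSys (F.P k) M (k' + 1)).Dom), Z.1 ⊆ X.1 → ∀ t ∈ terms L M Z,
            DifferentiableOn ℂ (fun z => TF k' Z t z old φ) U ∧
            ∀ z ∈ U, ‖TF k' Z t z old φ‖ ≤ weight L M c Z a t * Real.exp (a₅ * ((Z.1).card : ℝ))))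
    (h18 : ∀ k' : ℕ, k' < k →
      N18At (u3OfRecord₁₂ θ ((ReadingData.ofRecordAdm F M N (runTowers fun k₁ => toClusterTower (Gn k₁)) sp gauge hg T₀ hT₀ li).u3Objects θ.γ) k'))
    (hC5 : 0 ≤ li.C₅) (hθ1 : li.θ₅ < 1) (hC₀' : 2 * li.C₅ / (1 - li.θ₅) ≤ li.C₀)
    (hC₀ : 0 < li.C₀) (hθ : 0 < li.θ₅) (hA : 0 < li.A) (hμ1 : 1 ≤ li.μ) (hθμ : li.θ₅ ≤ li.μ) (hCM : li.C₀ ≤ 2 * li.A)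
    (hr : 0 < li.r) (hγ : 0 < θ.γ) (hs0 : 0 < li.s) (hs1 : li.s < 1) :
    N22At (u3OfRecord₁₂ θ ((ReadingData.ofRecordAdm F M N (runTowers fun k₁ => toClusterTower (Gn k₁)) sp gauge hg T₀ hT₀ li).u3Objects θ.γ) k) := by
  refine n22At_u3OfRecord₁₂_ofRecordAdm_runTowers_toClusterTower_of_n18Below_threeSchemas Gn sp gauge hg T₀ hT₀ li θ k Sg Rz hspk c hL hLc hN hA0 hr₁ hκ hrate hsmall
    hrenew ?_ ?_ ?_ h18 hC5 hθ1 hC₀' hC₀ hθ hA hμ1 hθμ hCM hr hγ hs0 hs1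
  · rw [hGn]
    exact fun k' hk => stepSchemaLoc_ofTerms_of_termwise k Sg Rz (TF k') (hlocT k' hk)
  · rw [hGn]
    exact fun k' hk => stepSchema226_ofTerms_of_termwise k Sg Rz (TF k') c (h226T k' hk)
  · rw [hGn]
    exact stepSchemaLast_ofTerms_of_termwise k Sg Rz TF k c hL hLc hN hA0 hr₁ hκ hrate hsmall hrenew hlastT

end TermFunEq

/-! ## §2 The same at one Stage-13 tuple -/

section TermFunEq13

variable {F : T4Family} (θ : Stage13Params F N) {L : ℕ} [NeZero L] (Gn : (k₁ : ℕ) → GenTower (F.P k₁) (MatA N) θ.τ9.M)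
  (sp : (k j : ℕ) → (domSys (F.P k) θ.τ9.M j).Dom → Set (CPair (F.P k) (MatA N)))
  (gauge : (k : ℕ) → GaugeField (F.P k) 0 (Node00.SU N) → GaugeField (F.P k) 0 (Node00.SU N) → ℝ) (hg : ∀ k U U', 0 ≤ gauge k U U')
  (T₀ : (k : ℕ) → GaugeField (F.P (k + 1)) 0 (Node00.SU N) → GaugeField (F.P k) 0 (Node00.SU N))
  (hT₀ : ∀ (k : ℕ) (U : GaugeField (F.P (k + 1)) 0 (Node00.SU N)),
    (∀ (j : ℕ) (Y : (domSys (F.P (k + 1)) θ.τ9.M j).Dom), ofBackgroundC (ιSU N) U ∈ sp (k + 1) j Y) →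
    ∀ (j : ℕ) (Y : (domSys (F.P k) θ.τ9.M j).Dom), ofBackgroundC (ιSU N) (T₀ k U) ∈ sp k j Y)
  (li : LetterInputs) (k : ℕ) (TF : GenTermFun (F.P k) (MatA N) θ.τ9.M L) {G : Type*} [GaugeGroup G]
  (Sg : Setting (MatA N) G) (Rz : Residual (F.P k) (MatA N))

open Classical in
/-- **§1 AT ONE STAGE-13 TUPLE** (`NeZero θ.τ9.M` from the context — e.g. `θ.Admissible`'s `1 ≤ τ9.M`; the Stage-13 bundle IS the Stage-12 bundle of `θ.toStage12Params`,
n22-e's `u3OfRecord₁₃_eq_u3OfRecord₁₂`, `rfl`). [cite: Balaban1988RG2Cluster, (2.9)-(2.15) pp.14-15, (2.26) p.17, Lemma 3 p.20 and (2.39)-(2.41) p.21; Balaban1987RG1, §1 p.263 and (2.12)-(2.13) p.268] -/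
theorem n22At_u3OfRecord₁₃_ofRecordAdm_runTowers_toClusterTower_of_n18Below_termFunEq [NeZero θ.τ9.M] {cs : SFConsts}
    (hGn : Gn k = GenTower.ofTerms L TF)
    (hspk : ∀ (j : ℕ) (Y : (domSys (F.P k) θ.τ9.M j).Dom), sp k j Y ⊆ spaceI Sg Rz θ.τ9.M j (domSites (F.P k) θ.τ9.M j Y) cs.α₀ cs.α₁)
    (c : B13.Consts) (hL : 8 ≤ c.L) (hLc : c.L = L) {a a₂ a₂' a₅ Aabs : ℝ}
    (hN : Lemma3Numerics c θ.τ9.M ((c.L : ℝ) / 2) a a₂ a₂' a₅ Aabs) {r₁ : ℝ} (hA0 : 0 ≤ c.C3act * c.ε₁) (hr₁ : 0 ≤ r₁) (hκ : li.κ ≤ r₁)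
    (hrate : r₁ + 2 * (64 * Real.log 162) + 2 ≤ (1 - 8 * c.δ) * ((c.L : ℝ) / 2) * c.κ)
    (hsmall : c.C3act * c.ε₁ * Real.exp (5 * r₁ + 1) * K₀ 64 8 * 9 * 64 ≤ 1)
    (hrenew : Real.exp 1 * 9 * 64 * K₀ 64 8 ^ 2 * (c.C3act * c.ε₁) ≤ li.A)
    (hlocT : ∀ (k' : ℕ), k' < k → ∀ (t : ℂ) (old old' : OlderTerms (F.P k) (MatA N) θ.τ9.M k') (φ : CPair (F.P k) (MatA N))
      (Z : (domSys (F.P k) θ.τ9.M (k' + 1)).Dom),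
      (∀ (j : Fin (k' + 1)) (Y : (domSys (F.P k) θ.τ9.M j).Dom) (ψ : CPair (F.P k) (MatA N)),
        ψ ∈ spaceI Sg Rz θ.τ9.M j (domSites (F.P k) θ.τ9.M j Y) cs.α₀ cs.α₁ → old j Y ψ = old' j Y ψ) →
      ∀ s ∈ terms L θ.τ9.M Z, TF k' Z s t old φ = TF k' Z s t old' φ)
    (h226T : ∀ (k' : ℕ), k' < k → ∀ (D : Set ℂ), IsOpen D → (∀ t ∈ Ioc (0 : ℝ) θ.γ, closedBall (t : ℂ) li.r ⊆ D) → ∀ (s : ℝ), s ∈ Ioc (0 : ℝ) θ.γ →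
      ∀ (cv : ℂ → OlderTerms (F.P k) (MatA N) θ.τ9.M k'),
      (∀ (j : Fin (k' + 1)) (Y : (domSys (F.P k) θ.τ9.M j).Dom) (ψ : CPair (F.P k) (MatA N)),
        ψ ∈ spaceI Sg Rz θ.τ9.M j (domSites (F.P k) θ.τ9.M j Y) cs.α₀ cs.α₁ →
        DifferentiableOn ℂ (fun z => cv z j Y ψ) D ∧ ∀ z ∈ D, ‖cv z j Y ψ‖ ≤ li.A * Real.exp (-(li.κ * torusTreeLen Y.1))) →
      ∀ (X : (domSys (F.P k) θ.τ9.M (k' + 1)).Dom) (φ : CPair (F.P k) (MatA N)),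
      φ ∈ spaceI Sg Rz θ.τ9.M (k' + 1) (domSites (F.P k) θ.τ9.M (k' + 1) X) cs.α₀ cs.α₁ →
      ∀ (Z : (domSys (F.P k) θ.τ9.M (k' + 1)).Dom), Z.1 ⊆ X.1 → ∀ t ∈ terms L θ.τ9.M Z,
        DifferentiableOn ℂ (fun z => TF k' Z t (s : ℂ) (cv z) φ) D ∧
        ∀ z ∈ D, ‖TF k' Z t (s : ℂ) (cv z) φ‖ ≤ weight L θ.τ9.M c Z a t * Real.exp (a₅ * ((Z.1).card : ℝ)))
    (hlastT : ∀ (k' : ℕ), k' < k → ∀ (old : OlderTerms (F.P k) (MatA N) θ.τ9.M k'), ∃ U : Set ℂ, IsOpen U ∧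
      (∀ t ∈ Ioc (0 : ℝ) θ.γ, closedBall (t : ℂ) li.r ⊆ U) ∧
      ((∀ (j : Fin (k' + 1)) (Y : (domSys (F.P k) θ.τ9.M j).Dom) (ψ : CPair (F.P k) (MatA N)),
          ψ ∈ spaceI Sg Rz θ.τ9.M j (domSites (F.P k) θ.τ9.M j Y) cs.α₀ cs.α₁ → ‖old j Y ψ‖ ≤ li.A * Real.exp (-(li.κ * torusTreeLen Y.1))) →
        ∀ (X : (domSys (F.P k) θ.τ9.M (k' + 1)).Dom) (φ : CPair (F.P k) (MatA N)),
        φ ∈ spaceI Sg Rz θ.τ9.M (k' + 1) (domSites (F.P k) θ.τ9.M (k' + 1) X) cs.α₀ cs.α₁ →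
          ∀ (Z : (domSys (F.P k) θ.τ9.M (k' + 1)).Dom), Z.1 ⊆ X.1 → ∀ t ∈ terms L θ.τ9.M Z,
            DifferentiableOn ℂ (fun z => TF k' Z t z old φ) U ∧
            ∀ z ∈ U, ‖TF k' Z t z old φ‖ ≤ weight L θ.τ9.M c Z a t * Real.exp (a₅ * ((Z.1).card : ℝ))))
    (h18 : ∀ k' : ℕ, k' < k →
      N18At (u3OfRecord₁₃ θ ((ReadingData.ofRecordAdm F θ.τ9.M N (runTowers fun k₁ => toClusterTower (Gn k₁)) sp gauge hg T₀ hT₀ li).u3Objects θ.γ) k'))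
    (hC5 : 0 ≤ li.C₅) (hθ1 : li.θ₅ < 1) (hC₀' : 2 * li.C₅ / (1 - li.θ₅) ≤ li.C₀)
    (hC₀ : 0 < li.C₀) (hθ5 : 0 < li.θ₅) (hA : 0 < li.A) (hμ1 : 1 ≤ li.μ) (hθμ : li.θ₅ ≤ li.μ) (hCM : li.C₀ ≤ 2 * li.A)
    (hr : 0 < li.r) (hγ : 0 < θ.γ) (hs0 : 0 < li.s) (hs1 : li.s < 1) :
    N22At (u3OfRecord₁₃ θ ((ReadingData.ofRecordAdm F θ.τ9.M N (runTowers fun k₁ => toClusterTower (Gn k₁)) sp gauge hg T₀ hT₀ li).u3Objects θ.γ) k) := by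
  rw [u3OfRecord₁₃_eq_u3OfRecord₁₂]
  exact n22At_u3OfRecord₁₂_ofRecordAdm_runTowers_toClusterTower_of_n18Below_termFunEq Gn sp gauge hg T₀ hT₀ li θ.toStage12Params k TF Sg Rz hGn hspk c hL hLc hN
    hA0 hr₁ hκ hrate hsmall hrenew hlocT h226T hlastT (fun k' hk => by rw [← u3OfRecord₁₃_eq_u3OfRecord₁₂]; exact h18 k' hk) hC5 hθ1 hC₀' hC₀ hθ5 hA hμ1 hθμ hCM hr
    hγ hs0 hs1

end TermFunEq13

/-! ## §3 IN THE K3‴ SKELETON's OWN CURRENCY: N22's conjunct of `KeyedRates rr` at the level-selected tuple reading of record, from the s1 term-level package -/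

section TupleReading

variable (Gn : (F : T4Family) → (θ : Stage13Params F N) → (k : ℕ) → GenTower (F.P k) (MatA N) θ.τ9.M)
  (sp : (F : T4Family) → (θ : Stage13Params F N) → (k j : ℕ) → (domSys (F.P k) θ.τ9.M j).Dom → Set (CPair (F.P k) (MatA N)))
  (gauge : (F : T4Family) → (θ : Stage13Params F N) → (k : ℕ) → GaugeField (F.P k) 0 (Node00.SU N) → GaugeField (F.P k) 0 (Node00.SU N) → ℝ)
  (hg : ∀ (F : T4Family) (θ : Stage13Params F N) (k : ℕ) (U U' : GaugeField (F.P k) 0 (Node00.SU N)), 0 ≤ gauge F θ k U U')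
  (T₀ : (F : T4Family) → (θ : Stage13Params F N) → (k : ℕ) → GaugeField (F.P (k + 1)) 0 (Node00.SU N) → GaugeField (F.P k) 0 (Node00.SU N))
  (hT : ∀ (F : T4Family) (θ : Stage13Params F N) (k : ℕ) (U : GaugeField (F.P (k + 1)) 0 (Node00.SU N)),
    (∀ (j : ℕ) (Y : (domSys (F.P (k + 1)) θ.τ9.M j).Dom), ofBackgroundC (ιSU N) U ∈ sp F θ (k + 1) j Y) →
      ∀ (j : ℕ) (X : (domSys (F.P k) θ.τ9.M j).Dom), ofBackgroundC (ιSU N) (T₀ F θ k U) ∈ sp F θ k j X)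
  (li : (F : T4Family) → Stage13Params F N → LetterInputs) (ℓ₃ : T4Family → NE3Letters₁₁)
  (ne2 : (F : T4Family) → Stage13Params F N → (ℕ → ℝ) → List (ULoop F) → ℕ → NE2Objects₁₁)
  (ne1 : (F : T4Family) → Stage13Params F N → (ℕ → ℝ) → List (ULoop F) → NE1pCarriers)
  (ksel : (F : T4Family) → Stage13Params F N → (ℕ → ℝ) → List (ULoop F) → ℕ)
  (Rg : (F : T4Family) → Stage13Params F N → Prop) {G : Type*} [GaugeGroup G]

open Classical in
/-- **N22's CONJUNCT OF `KeyedRates rr` AT THE LEVEL-SELECTED TUPLE READING OF RECORD ON THE GENERATED ADMISSIBLE RUN TOWERS, FROM THE s1 TERM-LEVEL PACKAGE, GUARDED BY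
ANY REGIME `Rg`** (rev 16's binder prefix `(θ.ZtUnity F N ∧ θ.SlotsNondegenerate₁₃ F N) →`, or `fun _ _ ↦ True`): for `rr F θ hP g₀ os := rateCarriersOfRecord₁₃ (readingOfRecord₁₃
(fun F θ ↦ ReadingData.ofRecordAdm F θ.τ9.M N (runTowers fun k ↦ toClusterTower (Gn F θ k)) …) ℓ₃ ne2 ne1) F θ hP g₀ os (ksel F θ g₀ os)`, node N18 at the run lengths BELOW the
selected one at the same reading + the letter signs + per `(F, θ, g₀, os)` in the regime ∃(`NeZero θ.τ9.M`, `Sg`, `Rz`, `cs`, `c`, `L`, `NeZero L`, `a … r₁`, a term functional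
`TF` at the selected run length): `Gn F θ (ksel …) = GenTower.ofTerms L TF` ∧ `hspk` ∧ numerals ∧ (S-loc-T) ∧ (S-226-T) ∧ (S-last-T) per term below the selected run length ⟹
`∀ F θ hP, Rg F θ → θ.Admissible F N → ∀ g₀ os, N22At (rr F θ hP g₀ os).u3` (§2 once per tuple; `readingOfRecord₁₃_bundle_u3`, `rfl`).  ONE conjunct of six — NOT a closer of
`stub_rates13`. [cite: Balaban1988RG2Cluster, (2.9)-(2.15) pp.14-15, (2.26) p.17, Lemma 3 p.20 and (2.39)-(2.41) p.21; Balaban1987RG1, (0.23)-(0.25) pp.256-257, §1 p.263 and (2.12)-(2.13) p.268] -/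
theorem n22_tupleReadingOfRecordOn_termFun_of_n18Below_termSchemas
    (h18 : ∀ (F : T4Family) (θ : Stage13Params F N) (hP : θ.Provisos₁₃ F N), Rg F θ → θ.Admissible F N → ∀ (g₀ : ℕ → ℝ) (os : List (ULoop F)),
      ∀ k' : ℕ, k' < ksel F θ g₀ os → N18At (u3OfRecord₁₃ θ ((ReadingData.ofRecordAdm F θ.τ9.M N (runTowers fun k => toClusterTower (Gn F θ k)) (sp F θ)
        (gauge F θ) (hg F θ) (T₀ F θ) (hT F θ) (li F θ)).u3Objects θ.γ) k'))
    (hnum : ∀ (F : T4Family) (θ : Stage13Params F N), θ.Provisos₁₃ F N → Rg F θ → θ.Admissible F N →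
      0 < (li F θ).C₀ ∧ 0 < (li F θ).θ₅ ∧ (li F θ).θ₅ < 1 ∧ 0 ≤ (li F θ).C₅ ∧ 2 * (li F θ).C₅ / (1 - (li F θ).θ₅) ≤ (li F θ).C₀ ∧ 0 < (li F θ).A ∧
        (li F θ).θ₅ ≤ (li F θ).μ ∧ (li F θ).C₀ ≤ 2 * (li F θ).A ∧ 0 < (li F θ).r ∧ 0 < (li F θ).s ∧ (li F θ).s < 1 ∧ 1 ≤ (li F θ).μ)
    (hdata : ∀ (F : T4Family) (θ : Stage13Params F N), θ.Provisos₁₃ F N → Rg F θ → θ.Admissible F N → ∀ (g₀ : ℕ → ℝ) (os : List (ULoop F)),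
      ∃ (_ : NeZero θ.τ9.M) (Sg : Setting (MatA N) G) (Rz : Residual (F.P (ksel F θ g₀ os)) (MatA N))
        (cs : SFConsts) (c : B13.Consts) (L : ℕ) (_ : NeZero L) (a a₂ a₂' a₅ Aabs r₁ : ℝ) (TF : GenTermFun (F.P (ksel F θ g₀ os)) (MatA N) θ.τ9.M L),
        Gn F θ (ksel F θ g₀ os) = GenTower.ofTerms L TF ∧
        (∀ (j : ℕ) (Y : (domSys (F.P (ksel F θ g₀ os)) θ.τ9.M j).Dom),
          sp F θ (ksel F θ g₀ os) j Y ⊆ spaceI Sg Rz θ.τ9.M j (domSites (F.P (ksel F θ g₀ os)) θ.τ9.M j Y) cs.α₀ cs.α₁) ∧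
        8 ≤ c.L ∧ c.L = L ∧ Lemma3Numerics c θ.τ9.M ((c.L : ℝ) / 2) a a₂ a₂' a₅ Aabs ∧ 0 ≤ c.C3act * c.ε₁ ∧ 0 ≤ r₁ ∧ (li F θ).κ ≤ r₁ ∧
        r₁ + 2 * (64 * Real.log 162) + 2 ≤ (1 - 8 * c.δ) * ((c.L : ℝ) / 2) * c.κ ∧
        c.C3act * c.ε₁ * Real.exp (5 * r₁ + 1) * K₀ 64 8 * 9 * 64 ≤ 1 ∧
        Real.exp 1 * 9 * 64 * K₀ 64 8 ^ 2 * (c.C3act * c.ε₁) ≤ (li F θ).A ∧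
        (∀ (k' : ℕ), k' < ksel F θ g₀ os → ∀ (t : ℂ) (old old' : OlderTerms (F.P (ksel F θ g₀ os)) (MatA N) θ.τ9.M k') (φ : CPair (F.P (ksel F θ g₀ os)) (MatA N))
          (Z : (domSys (F.P (ksel F θ g₀ os)) θ.τ9.M (k' + 1)).Dom),
          (∀ (j : Fin (k' + 1)) (Y : (domSys (F.P (ksel F θ g₀ os)) θ.τ9.M j).Dom) (ψ : CPair (F.P (ksel F θ g₀ os)) (MatA N)),
            ψ ∈ spaceI Sg Rz θ.τ9.M j (domSites (F.P (ksel F θ g₀ os)) θ.τ9.M j Y) cs.α₀ cs.α₁ → old j Y ψ = old' j Y ψ) →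
          ∀ s ∈ terms L θ.τ9.M Z, TF k' Z s t old φ = TF k' Z s t old' φ) ∧
        (∀ (k' : ℕ), k' < ksel F θ g₀ os → ∀ (D : Set ℂ), IsOpen D → (∀ t ∈ Ioc (0 : ℝ) θ.γ, closedBall (t : ℂ) (li F θ).r ⊆ D) →
          ∀ (s : ℝ), s ∈ Ioc (0 : ℝ) θ.γ → ∀ (cv : ℂ → OlderTerms (F.P (ksel F θ g₀ os)) (MatA N) θ.τ9.M k'),
          (∀ (j : Fin (k' + 1)) (Y : (domSys (F.P (ksel F θ g₀ os)) θ.τ9.M j).Dom) (ψ : CPair (F.P (ksel F θ g₀ os)) (MatA N)),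
            ψ ∈ spaceI Sg Rz θ.τ9.M j (domSites (F.P (ksel F θ g₀ os)) θ.τ9.M j Y) cs.α₀ cs.α₁ →
            DifferentiableOn ℂ (fun z => cv z j Y ψ) D ∧ ∀ z ∈ D, ‖cv z j Y ψ‖ ≤ (li F θ).A * Real.exp (-((li F θ).κ * torusTreeLen Y.1))) →
          ∀ (X : (domSys (F.P (ksel F θ g₀ os)) θ.τ9.M (k' + 1)).Dom) (φ : CPair (F.P (ksel F θ g₀ os)) (MatA N)),
          φ ∈ spaceI Sg Rz θ.τ9.M (k' + 1) (domSites (F.P (ksel F θ g₀ os)) θ.τ9.M (k' + 1) X) cs.α₀ cs.α₁ →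
          ∀ (Z : (domSys (F.P (ksel F θ g₀ os)) θ.τ9.M (k' + 1)).Dom), Z.1 ⊆ X.1 → ∀ t ∈ terms L θ.τ9.M Z,
            DifferentiableOn ℂ (fun z => TF k' Z t (s : ℂ) (cv z) φ) D ∧
            ∀ z ∈ D, ‖TF k' Z t (s : ℂ) (cv z) φ‖ ≤ weight L θ.τ9.M c Z a t * Real.exp (a₅ * ((Z.1).card : ℝ))) ∧
        (∀ (k' : ℕ), k' < ksel F θ g₀ os → ∀ (old : OlderTerms (F.P (ksel F θ g₀ os)) (MatA N) θ.τ9.M k'), ∃ U : Set ℂ, IsOpen U ∧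
          (∀ t ∈ Ioc (0 : ℝ) θ.γ, closedBall (t : ℂ) (li F θ).r ⊆ U) ∧
          ((∀ (j : Fin (k' + 1)) (Y : (domSys (F.P (ksel F θ g₀ os)) θ.τ9.M j).Dom) (ψ : CPair (F.P (ksel F θ g₀ os)) (MatA N)),
              ψ ∈ spaceI Sg Rz θ.τ9.M j (domSites (F.P (ksel F θ g₀ os)) θ.τ9.M j Y) cs.α₀ cs.α₁ →
              ‖old j Y ψ‖ ≤ (li F θ).A * Real.exp (-((li F θ).κ * torusTreeLen Y.1))) →
            ∀ (X : (domSys (F.P (ksel F θ g₀ os)) θ.τ9.M (k' + 1)).Dom) (φ : CPair (F.P (ksel F θ g₀ os)) (MatA N)),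
            φ ∈ spaceI Sg Rz θ.τ9.M (k' + 1) (domSites (F.P (ksel F θ g₀ os)) θ.τ9.M (k' + 1) X) cs.α₀ cs.α₁ →
            ∀ (Z : (domSys (F.P (ksel F θ g₀ os)) θ.τ9.M (k' + 1)).Dom), Z.1 ⊆ X.1 → ∀ t ∈ terms L θ.τ9.M Z,
              DifferentiableOn ℂ (fun z => TF k' Z t z old φ) U ∧
              ∀ z ∈ U, ‖TF k' Z t z old φ‖ ≤ weight L θ.τ9.M c Z a t * Real.exp (a₅ * ((Z.1).card : ℝ))))) :
    ∀ (F : T4Family) (θ : Stage13Params F N) (hP : θ.Provisos₁₃ F N), Rg F θ → θ.Admissible F N → ∀ (g₀ : ℕ → ℝ) (os : List (ULoop F)),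
      N22At (rateCarriersOfRecord₁₃ (readingOfRecord₁₃ (fun F θ => ReadingData.ofRecordAdm F θ.τ9.M N (runTowers fun k => toClusterTower (Gn F θ k)) (sp F θ)
        (gauge F θ) (hg F θ) (T₀ F θ) (hT F θ) (li F θ)) ℓ₃ ne2 ne1) F θ hP g₀ os (ksel F θ g₀ os)).u3 := by
  intro F θ hP hRg hθ g₀ os
  obtain ⟨hC₀, hθ5, hθ1, hC5, hC₀', hA, hθμ, hCM, hr, hs0, hs1, hμ1⟩ := hnum F θ hP hRg hθ
  obtain ⟨hMz, Sg, Rz, cs, c, L, hLz, a, a₂, a₂', a₅, Aabs, r₁, TF, hGn, hspk, hL, hLc, hN, hA0, hr₁, hκ, hrate, hsmall, hrenew, hlocT, h226T, hlastT⟩ :=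
    hdata F θ hP hRg hθ g₀ os
  rw [readingOfRecord₁₃_bundle_u3]
  exact n22At_u3OfRecord₁₃_ofRecordAdm_runTowers_toClusterTower_of_n18Below_termFunEq θ (Gn F θ) (sp F θ) (gauge F θ) (hg F θ) (T₀ F θ) (hT F θ) (li F θ)
    (ksel F θ g₀ os) TF Sg Rz hGn hspk c hL hLc hN hA0 hr₁ hκ hrate hsmall hrenew hlocT h226T hlastT (h18 F θ hP hRg hθ g₀ os) hC5 hθ1 hC₀' hC₀ hθ5 hA hμ1 hθμ hCM
    hr hθ.toStage9.gamma_pos hs0 hs1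

open Classical in
/-- **… UNGUARDED** (the skeleton's binder «`∀ F θ hP, θ.Admissible F N → ∀ g₀ os, N22At (rr F θ hP g₀ os).u3`» verbatim: the guarded form at `Rg := fun _ _ ↦ True`).
[cite: Balaban1988RG2Cluster, (2.9)-(2.15) pp.14-15, (2.26) p.17, Lemma 3 p.20 and (2.39)-(2.41) p.21; Balaban1987RG1, (0.23)-(0.25) pp.256-257, §1 p.263 and (2.12)-(2.13) p.268] -/
theorem n22_tupleReadingOfRecord_termFun_of_n18Below_termSchemas
    (h18 : ∀ (F : T4Family) (θ : Stage13Params F N) (hP : θ.Provisos₁₃ F N), θ.Admissible F N → ∀ (g₀ : ℕ → ℝ) (os : List (ULoop F)),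
      ∀ k' : ℕ, k' < ksel F θ g₀ os → N18At (u3OfRecord₁₃ θ ((ReadingData.ofRecordAdm F θ.τ9.M N (runTowers fun k => toClusterTower (Gn F θ k)) (sp F θ)
        (gauge F θ) (hg F θ) (T₀ F θ) (hT F θ) (li F θ)).u3Objects θ.γ) k'))
    (hnum : ∀ (F : T4Family) (θ : Stage13Params F N), θ.Provisos₁₃ F N → θ.Admissible F N →
      0 < (li F θ).C₀ ∧ 0 < (li F θ).θ₅ ∧ (li F θ).θ₅ < 1 ∧ 0 ≤ (li F θ).C₅ ∧ 2 * (li F θ).C₅ / (1 - (li F θ).θ₅) ≤ (li F θ).C₀ ∧ 0 < (li F θ).A ∧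
        (li F θ).θ₅ ≤ (li F θ).μ ∧ (li F θ).C₀ ≤ 2 * (li F θ).A ∧ 0 < (li F θ).r ∧ 0 < (li F θ).s ∧ (li F θ).s < 1 ∧ 1 ≤ (li F θ).μ)
    (hdata : ∀ (F : T4Family) (θ : Stage13Params F N), θ.Provisos₁₃ F N → θ.Admissible F N → ∀ (g₀ : ℕ → ℝ) (os : List (ULoop F)),
      ∃ (_ : NeZero θ.τ9.M) (Sg : Setting (MatA N) G) (Rz : Residual (F.P (ksel F θ g₀ os)) (MatA N))
        (cs : SFConsts) (c : B13.Consts) (L : ℕ) (_ : NeZero L) (a a₂ a₂' a₅ Aabs r₁ : ℝ) (TF : GenTermFun (F.P (ksel F θ g₀ os)) (MatA N) θ.τ9.M L),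
        Gn F θ (ksel F θ g₀ os) = GenTower.ofTerms L TF ∧
        (∀ (j : ℕ) (Y : (domSys (F.P (ksel F θ g₀ os)) θ.τ9.M j).Dom),
          sp F θ (ksel F θ g₀ os) j Y ⊆ spaceI Sg Rz θ.τ9.M j (domSites (F.P (ksel F θ g₀ os)) θ.τ9.M j Y) cs.α₀ cs.α₁) ∧
        8 ≤ c.L ∧ c.L = L ∧ Lemma3Numerics c θ.τ9.M ((c.L : ℝ) / 2) a a₂ a₂' a₅ Aabs ∧ 0 ≤ c.C3act * c.ε₁ ∧ 0 ≤ r₁ ∧ (li F θ).κ ≤ r₁ ∧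
        r₁ + 2 * (64 * Real.log 162) + 2 ≤ (1 - 8 * c.δ) * ((c.L : ℝ) / 2) * c.κ ∧
        c.C3act * c.ε₁ * Real.exp (5 * r₁ + 1) * K₀ 64 8 * 9 * 64 ≤ 1 ∧
        Real.exp 1 * 9 * 64 * K₀ 64 8 ^ 2 * (c.C3act * c.ε₁) ≤ (li F θ).A ∧
        (∀ (k' : ℕ), k' < ksel F θ g₀ os → ∀ (t : ℂ) (old old' : OlderTerms (F.P (ksel F θ g₀ os)) (MatA N) θ.τ9.M k') (φ : CPair (F.P (ksel F θ g₀ os)) (MatA N))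
          (Z : (domSys (F.P (ksel F θ g₀ os)) θ.τ9.M (k' + 1)).Dom),
          (∀ (j : Fin (k' + 1)) (Y : (domSys (F.P (ksel F θ g₀ os)) θ.τ9.M j).Dom) (ψ : CPair (F.P (ksel F θ g₀ os)) (MatA N)),
            ψ ∈ spaceI Sg Rz θ.τ9.M j (domSites (F.P (ksel F θ g₀ os)) θ.τ9.M j Y) cs.α₀ cs.α₁ → old j Y ψ = old' j Y ψ) →
          ∀ s ∈ terms L θ.τ9.M Z, TF k' Z s t old φ = TF k' Z s t old' φ) ∧
        (∀ (k' : ℕ), k' < ksel F θ g₀ os → ∀ (D : Set ℂ), IsOpen D → (∀ t ∈ Ioc (0 : ℝ) θ.γ, closedBall (t : ℂ) (li F θ).r ⊆ D) →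
          ∀ (s : ℝ), s ∈ Ioc (0 : ℝ) θ.γ → ∀ (cv : ℂ → OlderTerms (F.P (ksel F θ g₀ os)) (MatA N) θ.τ9.M k'),
          (∀ (j : Fin (k' + 1)) (Y : (domSys (F.P (ksel F θ g₀ os)) θ.τ9.M j).Dom) (ψ : CPair (F.P (ksel F θ g₀ os)) (MatA N)),
            ψ ∈ spaceI Sg Rz θ.τ9.M j (domSites (F.P (ksel F θ g₀ os)) θ.τ9.M j Y) cs.α₀ cs.α₁ →
            DifferentiableOn ℂ (fun z => cv z j Y ψ) D ∧ ∀ z ∈ D, ‖cv z j Y ψ‖ ≤ (li F θ).A * Real.exp (-((li F θ).κ * torusTreeLen Y.1))) →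
          ∀ (X : (domSys (F.P (ksel F θ g₀ os)) θ.τ9.M (k' + 1)).Dom) (φ : CPair (F.P (ksel F θ g₀ os)) (MatA N)),
          φ ∈ spaceI Sg Rz θ.τ9.M (k' + 1) (domSites (F.P (ksel F θ g₀ os)) θ.τ9.M (k' + 1) X) cs.α₀ cs.α₁ →
          ∀ (Z : (domSys (F.P (ksel F θ g₀ os)) θ.τ9.M (k' + 1)).Dom), Z.1 ⊆ X.1 → ∀ t ∈ terms L θ.τ9.M Z,
            DifferentiableOn ℂ (fun z => TF k' Z t (s : ℂ) (cv z) φ) D ∧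
            ∀ z ∈ D, ‖TF k' Z t (s : ℂ) (cv z) φ‖ ≤ weight L θ.τ9.M c Z a t * Real.exp (a₅ * ((Z.1).card : ℝ))) ∧
        (∀ (k' : ℕ), k' < ksel F θ g₀ os → ∀ (old : OlderTerms (F.P (ksel F θ g₀ os)) (MatA N) θ.τ9.M k'), ∃ U : Set ℂ, IsOpen U ∧
          (∀ t ∈ Ioc (0 : ℝ) θ.γ, closedBall (t : ℂ) (li F θ).r ⊆ U) ∧
          ((∀ (j : Fin (k' + 1)) (Y : (domSys (F.P (ksel F θ g₀ os)) θ.τ9.M j).Dom) (ψ : CPair (F.P (ksel F θ g₀ os)) (MatA N)),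
              ψ ∈ spaceI Sg Rz θ.τ9.M j (domSites (F.P (ksel F θ g₀ os)) θ.τ9.M j Y) cs.α₀ cs.α₁ →
              ‖old j Y ψ‖ ≤ (li F θ).A * Real.exp (-((li F θ).κ * torusTreeLen Y.1))) →
            ∀ (X : (domSys (F.P (ksel F θ g₀ os)) θ.τ9.M (k' + 1)).Dom) (φ : CPair (F.P (ksel F θ g₀ os)) (MatA N)),
            φ ∈ spaceI Sg Rz θ.τ9.M (k' + 1) (domSites (F.P (ksel F θ g₀ os)) θ.τ9.M (k' + 1) X) cs.α₀ cs.α₁ →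
            ∀ (Z : (domSys (F.P (ksel F θ g₀ os)) θ.τ9.M (k' + 1)).Dom), Z.1 ⊆ X.1 → ∀ t ∈ terms L θ.τ9.M Z,
              DifferentiableOn ℂ (fun z => TF k' Z t z old φ) U ∧
              ∀ z ∈ U, ‖TF k' Z t z old φ‖ ≤ weight L θ.τ9.M c Z a t * Real.exp (a₅ * ((Z.1).card : ℝ))))) :
    ∀ (F : T4Family) (θ : Stage13Params F N) (hP : θ.Provisos₁₃ F N), θ.Admissible F N → ∀ (g₀ : ℕ → ℝ) (os : List (ULoop F)),
      N22At (rateCarriersOfRecord₁₃ (readingOfRecord₁₃ (fun F θ => ReadingData.ofRecordAdm F θ.τ9.M N (runTowers fun k => toClusterTower (Gn F θ k)) (sp F θ)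
        (gauge F θ) (hg F θ) (T₀ F θ) (hT F θ) (li F θ)) ℓ₃ ne2 ne1) F θ hP g₀ os (ksel F θ g₀ os)).u3 :=
  fun F θ hP hθ g₀ os =>
    n22_tupleReadingOfRecordOn_termFun_of_n18Below_termSchemas Gn sp gauge hg T₀ hT li ℓ₃ ne2 ne1 ksel (fun _ _ => True) (G := G)
      (fun F θ hP _ hθ => h18 F θ hP hθ) (fun F θ hP _ hθ => hnum F θ hP hθ) (fun F θ hP _ hθ => hdata F θ hP hθ) F θ hP trivial hθ g₀ os

end TupleReading

/-! ## §4 (v1.1) HONESTY RIDER: the three per-term schemas hold at the ZERO term functional (joint satisfiability of the analytic clauses; the junk species located) -/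

section Rider

variable {F : T4Family} (k : ℕ) {𝔸 : Type*} [NormedRing 𝔸] [NormedAlgebra ℂ 𝔸] [CompleteSpace 𝔸] {G : Type*} [GaugeGroup G] {M : ℕ}
  (Sg : Setting 𝔸 G) (Rz : Residual (F.P k) 𝔸)

open Classical in
/-- **THE THREE PER-TERM SCHEMAS ARE JOINTLY SATISFIABLE — AT THE ZERO TERM FUNCTIONAL** (node00-def-W1 g6's honesty species `ofTerms_zero_H ∕ recTerm_ofTerms_zero` in this
file's currency; referees' A-column «clauses jointly satisfiable»): for `TF := 0` every term is the constant `0`, so (S-loc-T) is `rfl`, and (S-226-T) ∕ (S-last-T) hold on ANY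
domain (`U := univ`) because `0 ≤ weight L M c Z a t` (`weight_nonneg`, needs `0 ≤ α₆ε₂`) — the analytic inputs of 22′ §3 ∕ 24′ §3 therefore carry NO content by themselves: the
content is the IDENTIFICATION `Gn F θ k = GenTower.ofTerms L TF₀` with NODE 00's term functional OF RECORD, exactly as g0's zero-tower species said for the towers.
[cite: Balaban1988RG2Cluster, (2.14) p.15 and (2.26) p.17 (shape only)] -/
theorem termSchemas_zeroTermFun [NeZero M] {L : ℕ} [NeZero L] (K : ℕ) {cs : SFConsts} {γ r A κ : ℝ} (c : B13.Consts) {a a₅ : ℝ}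
    (hA6 : 0 ≤ c.α₆ * c.eps2) :
    (∀ (k' : ℕ), k' < K → ∀ (t : ℂ) (old old' : OlderTerms (F.P k) 𝔸 M k') (φ : CPair (F.P k) 𝔸) (Z : (domSys (F.P k) M (k' + 1)).Dom),
      (∀ (j : Fin (k' + 1)) (Y : (domSys (F.P k) M j).Dom) (ψ : CPair (F.P k) 𝔸), ψ ∈ spaceI Sg Rz M j (domSites (F.P k) M j Y) cs.α₀ cs.α₁ →
        old j Y ψ = old' j Y ψ) →
      ∀ s ∈ terms L M Z, (0 : GenTermFun (F.P k) 𝔸 M L) k' Z s t old φ = (0 : GenTermFun (F.P k) 𝔸 M L) k' Z s t old' φ) ∧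
    (∀ (k' : ℕ), k' < K → ∀ (D : Set ℂ), IsOpen D → (∀ t ∈ Ioc (0 : ℝ) γ, closedBall (t : ℂ) r ⊆ D) → ∀ (s : ℝ), s ∈ Ioc (0 : ℝ) γ →
      ∀ (cv : ℂ → OlderTerms (F.P k) 𝔸 M k'),
      (∀ (j : Fin (k' + 1)) (Y : (domSys (F.P k) M j).Dom) (ψ : CPair (F.P k) 𝔸), ψ ∈ spaceI Sg Rz M j (domSites (F.P k) M j Y) cs.α₀ cs.α₁ →
        DifferentiableOn ℂ (fun z => cv z j Y ψ) D ∧ ∀ z ∈ D, ‖cv z j Y ψ‖ ≤ A * Real.exp (-(κ * torusTreeLen Y.1))) →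
      ∀ (X : (domSys (F.P k) M (k' + 1)).Dom) (φ : CPair (F.P k) 𝔸), φ ∈ spaceI Sg Rz M (k' + 1) (domSites (F.P k) M (k' + 1) X) cs.α₀ cs.α₁ →
      ∀ (Z : (domSys (F.P k) M (k' + 1)).Dom), Z.1 ⊆ X.1 → ∀ t ∈ terms L M Z,
        DifferentiableOn ℂ (fun z => (0 : GenTermFun (F.P k) 𝔸 M L) k' Z t (s : ℂ) (cv z) φ) D ∧
        ∀ z ∈ D, ‖(0 : GenTermFun (F.P k) 𝔸 M L) k' Z t (s : ℂ) (cv z) φ‖ ≤ weight L M c Z a t * Real.exp (a₅ * ((Z.1).card : ℝ))) ∧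
    (∀ (k' : ℕ), k' < K → ∀ (old : OlderTerms (F.P k) 𝔸 M k'), ∃ U : Set ℂ, IsOpen U ∧ (∀ t ∈ Ioc (0 : ℝ) γ, closedBall (t : ℂ) r ⊆ U) ∧
      ((∀ (j : Fin (k' + 1)) (Y : (domSys (F.P k) M j).Dom) (ψ : CPair (F.P k) 𝔸), ψ ∈ spaceI Sg Rz M j (domSites (F.P k) M j Y) cs.α₀ cs.α₁ →
          ‖old j Y ψ‖ ≤ A * Real.exp (-(κ * torusTreeLen Y.1))) →
        ∀ (X : (domSys (F.P k) M (k' + 1)).Dom) (φ : CPair (F.P k) 𝔸), φ ∈ spaceI Sg Rz M (k' + 1) (domSites (F.P k) M (k' + 1) X) cs.α₀ cs.α₁ →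
          ∀ (Z : (domSys (F.P k) M (k' + 1)).Dom), Z.1 ⊆ X.1 → ∀ t ∈ terms L M Z,
            DifferentiableOn ℂ (fun z => (0 : GenTermFun (F.P k) 𝔸 M L) k' Z t z old φ) U ∧
            ∀ z ∈ U, ‖(0 : GenTermFun (F.P k) 𝔸 M L) k' Z t z old φ‖ ≤ weight L M c Z a t * Real.exp (a₅ * ((Z.1).card : ℝ)))) := by
  have hw : ∀ (k' : ℕ) (Z : (domSys (F.P k) M (k' + 1)).Dom) (t : TermLabel (F.P k) M k' L),
      ‖(0 : ℂ)‖ ≤ weight L M c Z a t * Real.exp (a₅ * ((Z.1).card : ℝ)) := fun k' Z t => by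
    rw [norm_zero]
    exact mul_nonneg (weight_nonneg c Z a hA6 t) (Real.exp_pos _).le
  refine ⟨fun k' _ t old old' φ Z _ s _ => rfl, fun k' _ D _ _ s _ cv _ X φ _ Z _ t _ => ⟨?_, fun z _ => ?_⟩, fun k' _ old => ⟨univ, isOpen_univ,
    fun t _ => subset_univ _, fun _ X φ _ Z _ t _ => ⟨?_, fun z _ => ?_⟩⟩⟩
  · exact differentiableOn_const (0 : ℂ)
  · exact hw k' Z t
  · exact differentiableOn_const (0 : ℂ)
  · exact hw k' Z t

end Rider

end YMDAG.N22.W1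

end
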